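import Summits.QuantumFields.BalabanUV.T4Continuum.Support.NE7SliceStepLetters
import Summits.QuantumFields.BalabanUV.T4Continuum.Support.NE3FluxGradientDictionary
import Summits.QuantumFields.BalabanUV.T4Continuum.Support.BlockAverageCurrent
import Summits.QuantumFields.BalabanUV.T4Continuum.Support.NE3SmoothLiftW
import Summits.QuantumFields.BalabanUV.T4Continuum.Support.AveragingDeficitKDatum
import Literature.MathematicalPhysics.QuantumFieldTheory.Balaban1983to89.B12Spaces329BCH
import HarnessLib

/-!
# NE7GaugeStepDeviation — THE SECOND-ORDER LETTERS OF ONE PERTURBATIVE GAUGE STEP `y ↦ e^{σ(y)}` (brick T3 of ROAD v4): the re-gauged log-link is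
# `log(e^{T}e^{A}e^{−T′}) = A − (T′ − T) + N`, **`‖N‖ ≤ 4(‖T‖ + ‖T′−T‖)(‖A‖ + ‖T′−T‖)`** (every term of the deviation carries a factor of the gauge data
# AND a factor of the field data — no `‖T‖²`, no `‖A‖²`), and the flat curl of the log-links moves by **`≤ 4‖σ‖·ε + 4(e^{4ρ} − 1)·max‖A′ − A‖`**
# (plaquette COVARIANCE + the Lipschitz letter of the plaquette remainder) (`NE7GaugeStepDeviation`)

Cell `pub-balaban`, lineage `t4-ne7-p1` (CRUX PROVER NE7 #1 = OWNER of row NE7), gen 74; memo `t4/b2b-balaban-t4-ne7-p1-g74/REP-FLAT-ROAD-v4.md` §2–§3.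
WHY.  ROAD v4's top step is a Newton scheme `Z_{i+1} = (Z_i − dσ_i) + N_i` whose convergence is measured by the sup of the deviation `N_i`, the flat CURL of
`N_i` (= `curl Z_{i+1} − curl Z_i`, `dσ_i` being curl-free) and its straight average — never by a divergence.  §1 is the deviation letter: with gen 73's
identity `e^{T}e^{A}e^{−T′} = e^{Ad_{e^T}A}·(e^{T}e^{−T′})` the logarithm is `X₁ + Y₁ + O(‖X₁‖‖Y₁‖)` ([B7] (31) sharp cross term, tree `B7Eq31BCH.eq31_of_sum_le`),
`X₁ = Ad_{e^T}A = A + O(‖T‖‖A‖)` (`norm_Ad_sub_le`), `Y₁ = log(e^{T}e^{−T′}) = −(T′−T) + O(‖T‖‖T′−T‖)` (the bilinear Lipschitz letter of the BCH remainder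
`B12Spaces329BCH.norm_bchRem_sub_bchRem_le_sharp` against `log(e^{T}e^{−T}) = 0`).  §2 is the curl letter: the plaquette of the re-gauged field is the
CONJUGATE `Ad_{e^{σ(x)}}` of the old one (`hol_gaugeAct_closed`), so the plaquettes move by `≤ 2‖e^{σ}−1‖·ε`, while `curl = (plaquette − 1) − remainder`
with p2's Lipschitz letter `NE7GradientCurrency.norm_plaqRem_sub_plaqRem_le` for the remainder.  §3 packages the step on the T4 carriers.
CONTENT ([folklore]; 0 def, 0 sorry).  §1 `norm_mlog_gaugeStep_sub_linear_le`; §2 `norm_curlAt_flat_sub_curlAt_flat_le_of_gaugeAct`; §3 `gaugeStep_letters`.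
HONEST FRAMING (page 1): [folklore] Banach-∕C*-algebra calculus of `exp`∕`log` BY NAME over the tree; nothing of Bałaban's is used or claimed; the Newton scheme
(T4), REP♭ and (APE) are NOT proved here; NE7 NOT PRINTED ∕ NOT PROVED (0∕1); spine PROVED 0∕9; rung (B)+1 finite T⁴ — NOT infinite volume, NOT mass gap, NOT
BetaPertH, NOT Clay.  PLACEMENT: our lemma, under `Summits/QuantumFields/BalabanUV/`.
Continuum YM on T⁴ ⇐ BetaPertH ∧ nine spine estimates (0/9 proved); BetaPertH ⇐ (D1) ∧ (D4) ∧ CAP+tail; G-an2-4 gates asym, D1 and NE2/3/4.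
-/

set_option autoImplicit false

open scoped BigOperators Matrix Matrix.Norms.L2Operator
open NormedSpace Finset

namespace Summit.QuantumFields.BalabanUV.T4Continuum.NE7GaugeStepDeviation

open Literature.MathematicalPhysics.QuantumFieldTheory.Balaban1983to89
open B7Prop1Explicit B7Prop2Explicit MatrixLog
open T4AveragingDeficitWall (Ad IsUnitaryCfg IsSkewDir SmallField vary curlAt)
open T4AveragingDeficitWallBoundary (IsPeriodicCfg)
open AveragingDeficitPeriodicCounting (IsPeriodicDir)
open AveragingDeficitNearIdentity (norm_Ad_sub_le)
open AveragingDeficitTransport (norm_Ad_of_unitary)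
open AveragingDeficitKDatum (isUnitaryCfg_gaugeAct)
open BlockAverageCurrent (smallField_gaugeAct)
open BlockAveragePushDirSplit (flat)
open NE3EnergyShapes (IsUnitarySite IsPeriodicSite)
open NE3SmoothLiftCurl (curlAt_flat_eq)
open NE3SmoothLiftW (isPeriodicCfg_gaugeAct)
open NE3FluxGradientDictionary (Ad_exp_eq)
open NE7GradientCurrency (hol_vary_flat_plaqWord norm_plaqRem_sub_plaqRem_le vary_flat_one_apply)
open NE7ExpLogSecondOrder (real_exp_sub_one_le_two_mul)
open B12Membership313II (bchLog exp_bchLog)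
open B12QPrime348 (bchLog_zero_right)
open B12Spaces329BCH (norm_bchRem_sub_bchRem_le_sharp)
open B7Eq31BCH (eq31_of_sum_le)
open B7BlockAvgLog (mlog_exp)

noncomputable section

variable {d : ℕ} {n : Type*} [Fintype n] [DecidableEq n]

/-! ## §1 The deviation letter -/

/-- **THE DEVIATION OF THE RE-GAUGED LOG-LINK FROM ITS LINEAR PREDICTION**: for skew `T, T′` and any `A` with `‖T‖ ≤ t`, `‖A‖ ≤ α`, `‖T′ − T‖ ≤ δ`,
`t, α, δ ≤ 1∕40`: **`‖log(e^{T}e^{A}e^{−T′}) − (A − (T′ − T))‖ ≤ 4(t + δ)(α + δ)`**. [folklore] -/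
theorem norm_mlog_gaugeStep_sub_linear_le [Nonempty n] {T T' A : Matrix n n ℂ} (hT : T ∈ skewAdjoint (Matrix n n ℂ))
    {t α δ : ℝ} (ht : ‖T‖ ≤ t) (hA : ‖A‖ ≤ α) (hD : ‖T' - T‖ ≤ δ) (ht40 : t ≤ 1 / 40) (hα40 : α ≤ 1 / 40) (hδ40 : δ ≤ 1 / 40) :
    ‖mlog (exp T * exp A * exp (-T')) - (A - (T' - T))‖ ≤ 4 * (t + δ) * (α + δ) := by
  letI : CStarAlgebra (Matrix n n ℂ) := {}
  letI : NormedAlgebra ℚ (Matrix n n ℂ) := NormedAlgebra.restrictScalars ℚ ℝ (Matrix n n ℂ)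
  have ht0 : 0 ≤ t := (norm_nonneg _).trans ht
  have hα0 : 0 ≤ α := (norm_nonneg _).trans hA
  have hδ0 : 0 ≤ δ := (norm_nonneg _).trans hD
  -- the unitary `u = e^{T}` and the conjugated field `X₁ = Ad_u A`
  have huU : expUnit T ∈ unitaryUnits (Matrix n n ℂ) :=
    mem_unitaryUnits.mpr (by rw [val_expUnit]; exact exp_mem_unitary_of_mem_skewAdjoint hT)
  set X₁ : Matrix n n ℂ := Ad (expUnit T) A with hX₁
  have hX₁n : ‖X₁‖ = ‖A‖ := norm_Ad_of_unitary huU A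
  have hu1 : ‖((expUnit T : (Matrix n n ℂ)ˣ) : Matrix n n ℂ) - 1‖ ≤ 2 * t := by
    rw [val_expUnit]
    exact (norm_exp_sub_one_le_of_norm_le ht).1.trans (real_exp_sub_one_le_two_mul ht0 (by linarith))
  have hX₁A : ‖X₁ - A‖ ≤ 4 * t * α := by
    calc ‖X₁ - A‖ ≤ 2 * ‖((expUnit T : (Matrix n n ℂ)ˣ) : Matrix n n ℂ) - 1‖ * ‖A‖ := norm_Ad_sub_le huU A
      _ ≤ 2 * (2 * t) * α := by gcongr
      _ = 4 * t * α := by ring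
  -- `Y₁ = log(e^{T}e^{−T′})` and its deviation from `−(T′−T)`
  set Y₁ : Matrix n n ℂ := bchLog T (-T') with hY₁
  have hT'n : ‖-T'‖ ≤ t + δ := by
    rw [norm_neg]
    calc ‖T'‖ = ‖(T' - T) + T‖ := by rw [sub_add_cancel]
      _ ≤ δ + t := (norm_add_le _ _).trans (add_le_add hD ht)
      _ = t + δ := add_comm _ _
  have hTn' : ‖-T‖ ≤ t + δ := by rw [norm_neg]; linarith
  have hG0 : bchLog T (-T) - (T + -T) = 0 := by
    have h1 : exp T * exp (-T) = (1 : Matrix n n ℂ) := by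
      rw [← exp_add_of_commute (Commute.refl T).neg_right, add_neg_cancel, exp_zero]
    rw [add_neg_cancel, sub_zero]
    change mlog (exp T * exp (-T)) = 0
    rw [h1, mlog_one]
  have hY₁D : ‖Y₁ - (-(T' - T))‖ ≤ 4 * t * δ := by
    have h := norm_bchRem_sub_bchRem_le_sharp (X₁ := T) (Y₁ := -T') (X₂ := T) (Y₂ := -T) ht ht hT'n hTn' (by linarith)
    rw [hG0, sub_zero, sub_self, norm_zero, mul_zero, zero_add, show -T' - -T = -(T' - T) by abel, norm_neg] at h
    have he : bchLog T (-T') - (T + -T') = Y₁ - (-(T' - T)) := by rw [hY₁]; abel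
    rw [← he]
    calc ‖bchLog T (-T') - (T + -T')‖ ≤ 4 * (t * ‖T' - T‖) := h
      _ ≤ 4 * (t * δ) := by gcongr
      _ = 4 * t * δ := by ring
  have hY₁n : ‖Y₁‖ ≤ 2 * δ := by
    have h4 : 4 * t * δ ≤ δ := by nlinarith
    calc ‖Y₁‖ = ‖(Y₁ - (-(T' - T))) + (-(T' - T))‖ := by rw [sub_add_cancel]
      _ ≤ 4 * t * δ + δ := (norm_add_le _ _).trans (add_le_add hY₁D (by rw [norm_neg]; exact hD))
      _ ≤ 2 * δ := by linarith
  -- the factorisation `e^{T}e^{A}e^{−T′} = e^{X₁}·e^{Y₁}`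
  have hprod1 : exp T * exp A * exp (-T) = exp X₁ := by
    rw [hX₁, ← Ad_exp_eq]
    simp only [Ad, val_expUnit, val_inv_expUnit]
  have hsmall : ‖exp T * exp (-T') - 1‖ < 1 := by
    have h := B12Membership313II.norm_exp_mul_exp_sub_one_le_of_le (X := T) (Y := -T') (s := 2 * t + δ) (by linarith)
    have h2 : Real.exp (2 * t + δ) - 1 ≤ 2 * (2 * t + δ) := real_exp_sub_one_le_two_mul (by positivity) (by linarith)
    exact h.trans_lt (by linarith)
  have hprod2 : exp T * exp (-T') = exp Y₁ := (exp_bchLog hsmall).symm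
  have hTT : exp (-T) * exp T = (1 : Matrix n n ℂ) := by
    rw [← exp_add_of_commute (Commute.refl T).neg_left, neg_add_cancel, exp_zero]
  have hW : exp T * exp A * exp (-T') = exp X₁ * exp Y₁ := by
    calc exp T * exp A * exp (-T') = exp T * exp A * (exp (-T) * exp T) * exp (-T') := by rw [hTT, mul_one]
      _ = (exp T * exp A * exp (-T)) * (exp T * exp (-T')) := by simp only [mul_assoc]
      _ = exp X₁ * exp Y₁ := by rw [hprod1, hprod2]
  -- [B7] (31): the cross term
  have h31 : ‖mlog (exp X₁ * exp Y₁) - X₁ - Y₁‖ ≤ 2 * ‖X₁‖ * ‖Y₁‖ := eq31_of_sum_le (by rw [hX₁n]; linarith [hA])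
  have hsplit : mlog (exp T * exp A * exp (-T')) - (A - (T' - T))
      = (mlog (exp X₁ * exp Y₁) - X₁ - Y₁) + (X₁ - A) + (Y₁ - (-(T' - T))) := by
    rw [hW]; abel
  rw [hsplit]
  have hcross : 2 * ‖X₁‖ * ‖Y₁‖ ≤ 2 * α * (2 * δ) := by
    rw [hX₁n]; gcongr
  calc ‖(mlog (exp X₁ * exp Y₁) - X₁ - Y₁) + (X₁ - A) + (Y₁ - (-(T' - T)))‖
      ≤ ‖mlog (exp X₁ * exp Y₁) - X₁ - Y₁‖ + ‖X₁ - A‖ + ‖Y₁ - (-(T' - T))‖ := norm_add₃_le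
    _ ≤ 2 * α * (2 * δ) + 4 * t * α + 4 * t * δ := add_le_add (add_le_add (h31.trans hcross) hX₁A) hY₁D
    _ = 4 * (t + δ) * (α + δ) - 4 * δ * δ := by ring
    _ ≤ 4 * (t + δ) * (α + δ) := by nlinarith

/-! ## §2 The curl letter: plaquette covariance + the Lipschitz remainder -/

/-- **THE FLAT CURL OF THE LOG-LINKS UNDER A GAUGE STEP**: for a unitary `W = e^{A}` with `SmallField W ε`, a skew gauge function `σ` with `‖σ‖ ≤ t ≤ 1`,
and `W′ := W^{e^{σ}} = e^{A′}` with `‖A‖, ‖A′‖ ≤ ρ` and `‖A′ − A‖ ≤ D` on every link: **`‖curl₁A′ − curl₁A‖ ≤ 4tε + (e^{4ρ} − 1)·4D`** at every plaquette —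
the plaquette of `W′` is the conjugate `Ad_{e^{σ(x)}}` of that of `W` (moves by `≤ 2‖e^{σ}−1‖·ε`), and `curl = (plaquette − 1) − remainder` with p2's Lipschitz
letter for the remainder. [folklore] -/
theorem norm_curlAt_flat_sub_le_of_gaugeAct [Nonempty n] {W : Site (d + 1) → Fin (d + 1) → (Matrix n n ℂ)ˣ} {ε : ℝ} (hε : 0 ≤ ε) (hWε : SmallField W ε)
    {A A' : Site (d + 1) → Fin (d + 1) → Matrix n n ℂ} (hWA : ∀ (y : Site (d + 1)) (κ : Fin (d + 1)), ((W y κ : (Matrix n n ℂ)ˣ) : Matrix n n ℂ) = exp (A y κ))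
    {σ : Site (d + 1) → Matrix n n ℂ} (hσs : ∀ y, σ y ∈ skewAdjoint (Matrix n n ℂ)) {t : ℝ} (hσn : ∀ y, ‖σ y‖ ≤ t) (ht1 : t ≤ 1)
    (hWA' : ∀ (y : Site (d + 1)) (κ : Fin (d + 1)), ((gaugeAct (fun y => expUnit (σ y)) W y κ : (Matrix n n ℂ)ˣ) : Matrix n n ℂ) = exp (A' y κ))
    {ρ : ℝ} (hA : ∀ (y : Site (d + 1)) (κ : Fin (d + 1)), ‖A y κ‖ ≤ ρ) (hA' : ∀ (y : Site (d + 1)) (κ : Fin (d + 1)), ‖A' y κ‖ ≤ ρ)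
    {D : ℝ} (hAA' : ∀ (y : Site (d + 1)) (κ : Fin (d + 1)), ‖A' y κ - A y κ‖ ≤ D) (x : Site (d + 1)) (μ ν : Fin (d + 1)) :
    ‖curlAt (flat (d := d + 1) (n := n)) A' x μ ν - curlAt (flat (d := d + 1) (n := n)) A x μ ν‖ ≤ 4 * t * ε + (Real.exp (4 * ρ) - 1) * (4 * D) := by
  letI : CStarAlgebra (Matrix n n ℂ) := {}
  letI : NormedAlgebra ℚ (Matrix n n ℂ) := NormedAlgebra.restrictScalars ℚ ℝ (Matrix n n ℂ)
  have ht0 : 0 ≤ t := (norm_nonneg _).trans (hσn 0)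
  have hD0 : 0 ≤ D := (norm_nonneg _).trans (hAA' 0 0)
  have hρ0 : 0 ≤ ρ := (norm_nonneg _).trans (hA 0 0)
  have hexp0 : 0 ≤ Real.exp (4 * ρ) - 1 := by linarith [Real.add_one_le_exp (4 * ρ)]
  by_cases hμν : μ = ν
  · subst hμν
    have h0 : ∀ B : Site (d + 1) → Fin (d + 1) → Matrix n n ℂ, curlAt (flat (d := d + 1) (n := n)) B x μ μ = 0 := fun B => by
      rw [curlAt_flat_eq]; abel
    rw [h0, h0, sub_zero, norm_zero]
    positivity
  -- the two plaquettes
  have hgW : vary (flat (d := d + 1) (n := n)) A 1 = W := by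
    funext y κ; apply Units.ext; rw [vary_flat_one_apply, val_expUnit, hWA]
  have hgW' : vary (flat (d := d + 1) (n := n)) A' 1 = gaugeAct (fun y => expUnit (σ y)) W := by
    funext y κ; apply Units.ext; rw [vary_flat_one_apply, val_expUnit, hWA']
  set P : Matrix n n ℂ := ((hol W x (plaqWord μ ν) : (Matrix n n ℂ)ˣ) : Matrix n n ℂ) with hP
  set P' : Matrix n n ℂ := ((hol (gaugeAct (fun y => expUnit (σ y)) W) x (plaqWord μ ν) : (Matrix n n ℂ)ˣ) : Matrix n n ℂ) with hP'
  have hPexp : P = exp (A x μ) * exp (A (x + e μ) ν) * exp (-A (x + e ν) μ) * exp (-A x ν) := by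
    rw [hP, ← hgW, hol_vary_flat_plaqWord]
  have hP'exp : P' = exp (A' x μ) * exp (A' (x + e μ) ν) * exp (-A' (x + e ν) μ) * exp (-A' x ν) := by
    rw [hP', ← hgW', hol_vary_flat_plaqWord]
  -- covariance: `P′ = Ad_{e^{σ(x)}} P`
  have huU : expUnit (σ x) ∈ unitaryUnits (Matrix n n ℂ) :=
    mem_unitaryUnits.mpr (by rw [val_expUnit]; exact exp_mem_unitary_of_mem_skewAdjoint (hσs x))
  have hcov : P' = Ad (expUnit (σ x)) P := by
    rw [hP', hol_gaugeAct_closed _ _ _ _ (disp_plaqWord μ ν), Units.val_mul, Units.val_mul, hP]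
    rfl
  have hu1 : ‖((expUnit (σ x) : (Matrix n n ℂ)ˣ) : Matrix n n ℂ) - 1‖ ≤ 2 * t := by
    rw [val_expUnit]
    exact (norm_exp_sub_one_le_of_norm_le (hσn x)).1.trans (real_exp_sub_one_le_two_mul ht0 ht1)
  have hPP : ‖(P' - 1) - (P - 1)‖ ≤ 4 * t * ε := by
    have h1 : (P' - 1) - (P - 1) = Ad (expUnit (σ x)) (P - 1) - (P - 1) := by
      rw [T4AveragingDeficitNonAbelian.Ad_sub, hcov]
      simp only [Ad, mul_one, Units.mul_inv]
    rw [h1]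
    calc ‖Ad (expUnit (σ x)) (P - 1) - (P - 1)‖ ≤ 2 * ‖((expUnit (σ x) : (Matrix n n ℂ)ˣ) : Matrix n n ℂ) - 1‖ * ‖P - 1‖ := norm_Ad_sub_le huU _
      _ ≤ 2 * (2 * t) * ε := by
          have := hWε x μ ν hμν
          gcongr
      _ = 4 * t * ε := by ring
  -- the remainders
  have hrem := norm_plaqRem_sub_plaqRem_le (𝔸 := Matrix n n ℂ)
    (x₁ := A' x μ) (x₂ := A' (x + e μ) ν) (x₃ := -A' (x + e ν) μ) (x₄ := -A' x ν)
    (y₁ := A x μ) (y₂ := A (x + e μ) ν) (y₃ := -A (x + e ν) μ) (y₄ := -A x ν) (ρ := ρ)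
    (hA' x μ) (hA' _ ν) (by rw [norm_neg]; exact hA' _ μ) (by rw [norm_neg]; exact hA' x ν)
    (hA x μ) (hA _ ν) (by rw [norm_neg]; exact hA _ μ) (by rw [norm_neg]; exact hA x ν)
  have hcurl : ∀ B : Site (d + 1) → Fin (d + 1) → Matrix n n ℂ,
      curlAt (flat (d := d + 1) (n := n)) B x μ ν = B x μ + B (x + e μ) ν + -B (x + e ν) μ + -B x ν := fun B => by
    rw [curlAt_flat_eq]; abel
  have hsplit : curlAt (flat (d := d + 1) (n := n)) A' x μ ν - curlAt (flat (d := d + 1) (n := n)) A x μ ν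
      = ((P' - 1) - (P - 1))
        - ((exp (A' x μ) * exp (A' (x + e μ) ν) * exp (-A' (x + e ν) μ) * exp (-A' x ν) - 1 - (A' x μ + A' (x + e μ) ν + -A' (x + e ν) μ + -A' x ν))
          - (exp (A x μ) * exp (A (x + e μ) ν) * exp (-A (x + e ν) μ) * exp (-A x ν) - 1 - (A x μ + A (x + e μ) ν + -A (x + e ν) μ + -A x ν))) := by
    rw [hcurl, hcurl, hPexp, hP'exp]; abel
  rw [hsplit]
  refine (norm_sub_le _ _).trans (add_le_add hPP (hrem.trans ?_))
  refine mul_le_mul_of_nonneg_left ?_ hexp0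
  have e3 : ‖-A' (x + e ν) μ - -A (x + e ν) μ‖ = ‖A' (x + e ν) μ - A (x + e ν) μ‖ := by
    rw [show -A' (x + e ν) μ - -A (x + e ν) μ = -(A' (x + e ν) μ - A (x + e ν) μ) by abel, norm_neg]
  have e4 : ‖-A' x ν - -A x ν‖ = ‖A' x ν - A x ν‖ := by
    rw [show -A' x ν - -A x ν = -(A' x ν - A x ν) by abel, norm_neg]
  rw [e3, e4]
  linarith [hAA' x μ, hAA' (x + e μ) ν, hAA' (x + e ν) μ, hAA' x ν]

/-! ## §3 The gauge step on the T4 carriers, packaged -/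

/-- **ONE GAUGE STEP `W ↦ W^{e^{σ}}` WITH ALL ITS LETTERS** (dimension `d + 1`): `W` unitary `P`-periodic with `SmallField W ε`, links `r`-close to `1`
(`r ≤ 1∕80`); `σ` skew `P`-periodic with `‖σ‖ ≤ t ≤ 1∕40`, `‖dσ‖ ≤ δ ≤ 1∕40`, and `‖log W − dσ‖ ≤ ρ₁` with `r′ := 2ρ₁ + 8(t+δ)δ ≤ 1∕80`.  Then `g := e^{σ}` is
unitary periodic, `W′ := W^{g}` is unitary periodic with `SmallField W′ ε`, links `r′`-close to `1`, **`‖log W′ − (log W − dσ)‖ ≤ 4(t+δ)(2r+δ)`**, and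
**`‖curl₁ log W′ − curl₁ log W‖ ≤ 4tε + (e^{4ρ} − 1)·4(δ + 4(t+δ)(2r+δ))`** for any `ρ ≥ 2r, 2r′`. [folklore] -/
theorem gaugeStep_letters [Nonempty n] {W : Site (d + 1) → Fin (d + 1) → (Matrix n n ℂ)ˣ} (hWu : IsUnitaryCfg W) {P : ℤ} (hWP : IsPeriodicCfg W P)
    {ε : ℝ} (hε : 0 ≤ ε) (hWε : SmallField W ε) {r : ℝ} (hr : ∀ (y : Site (d + 1)) (κ : Fin (d + 1)), ‖((W y κ : (Matrix n n ℂ)ˣ) : Matrix n n ℂ) - 1‖ ≤ r)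
    (hr80 : r ≤ 1 / 80) {σ : Site (d + 1) → Matrix n n ℂ} (hσs : ∀ y, σ y ∈ skewAdjoint (Matrix n n ℂ))
    (hσP : ∀ (y : Site (d + 1)) (i : Fin (d + 1)), σ (y + P • e i) = σ y) {t δ ρ₁ ρ : ℝ} (hσn : ∀ y, ‖σ y‖ ≤ t)
    (hdσ : ∀ (y : Site (d + 1)) (κ : Fin (d + 1)), ‖σ (y + e κ) - σ y‖ ≤ δ)
    (hρ₁ : ∀ (y : Site (d + 1)) (κ : Fin (d + 1)), ‖mlog ((W y κ : (Matrix n n ℂ)ˣ) : Matrix n n ℂ) - (σ (y + e κ) - σ y)‖ ≤ ρ₁)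
    (ht : t ≤ 1 / 40) (hδ : δ ≤ 1 / 40) (hr' : 2 * ρ₁ + 8 * (t + δ) * δ ≤ 1 / 80) (hρa : 2 * r ≤ ρ) (hρb : 2 * (2 * ρ₁ + 8 * (t + δ) * δ) ≤ ρ) :
    IsUnitarySite (fun y => expUnit (σ y)) ∧ IsPeriodicSite (fun y => expUnit (σ y)) P ∧
    IsUnitaryCfg (gaugeAct (fun y => expUnit (σ y)) W) ∧ IsPeriodicCfg (gaugeAct (fun y => expUnit (σ y)) W) P ∧
    SmallField (gaugeAct (fun y => expUnit (σ y)) W) ε ∧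
    (∀ (y : Site (d + 1)) (κ : Fin (d + 1)), ‖((gaugeAct (fun y => expUnit (σ y)) W y κ : (Matrix n n ℂ)ˣ) : Matrix n n ℂ) - 1‖ ≤ 2 * ρ₁ + 8 * (t + δ) * δ) ∧
    (∀ (y : Site (d + 1)) (κ : Fin (d + 1)),
      ‖mlog ((gaugeAct (fun y => expUnit (σ y)) W y κ : (Matrix n n ℂ)ˣ) : Matrix n n ℂ)
          - (mlog ((W y κ : (Matrix n n ℂ)ˣ) : Matrix n n ℂ) - (σ (y + e κ) - σ y))‖ ≤ 4 * (t + δ) * (2 * r + δ)) ∧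
    (∀ (x : Site (d + 1)) (μ ν : Fin (d + 1)),
      ‖curlAt (flat (d := d + 1) (n := n)) (fun y κ => mlog ((gaugeAct (fun y => expUnit (σ y)) W y κ : (Matrix n n ℂ)ˣ) : Matrix n n ℂ)) x μ ν
          - curlAt (flat (d := d + 1) (n := n)) (fun y κ => mlog ((W y κ : (Matrix n n ℂ)ˣ) : Matrix n n ℂ)) x μ ν‖
        ≤ 4 * t * ε + (Real.exp (4 * ρ) - 1) * (4 * (δ + 4 * (t + δ) * (2 * r + δ)))) := by
  letI : CStarAlgebra (Matrix n n ℂ) := {}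
  letI : NormedAlgebra ℚ (Matrix n n ℂ) := NormedAlgebra.restrictScalars ℚ ℝ (Matrix n n ℂ)
  have hr0 : 0 ≤ r := (norm_nonneg _).trans (hr 0 0)
  have ht0 : 0 ≤ t := (norm_nonneg _).trans (hσn 0)
  have hδ0 : 0 ≤ δ := (norm_nonneg _).trans (hdσ 0 0)
  -- the gauge
  have hgU : IsUnitarySite (fun y => expUnit (σ y)) := fun y =>
    mem_unitaryUnits.mpr (by rw [val_expUnit]; exact exp_mem_unitary_of_mem_skewAdjoint (hσs y))
  have hgP : IsPeriodicSite (fun y => expUnit (σ y)) P := fun y i => by simp only [hσP y i]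
  have hW'u : IsUnitaryCfg (gaugeAct (fun y => expUnit (σ y)) W) := isUnitaryCfg_gaugeAct hgU hWu
  have hW'P : IsPeriodicCfg (gaugeAct (fun y => expUnit (σ y)) W) P := isPeriodicCfg_gaugeAct hgP hWP
  have hW'ε : SmallField (gaugeAct (fun y => expUnit (σ y)) W) ε := smallField_gaugeAct hgU hWε
  -- the old log-links
  set A : Site (d + 1) → Fin (d + 1) → Matrix n n ℂ := fun y κ => mlog ((W y κ : (Matrix n n ℂ)ˣ) : Matrix n n ℂ) with hAdef
  have hWA : ∀ (y : Site (d + 1)) (κ : Fin (d + 1)), ((W y κ : (Matrix n n ℂ)ˣ) : Matrix n n ℂ) = exp (A y κ) := fun y κ =>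
    (exp_mlog ((hr y κ).trans_lt (by linarith))).symm
  have hAn : ∀ (y : Site (d + 1)) (κ : Fin (d + 1)), ‖A y κ‖ ≤ 2 * r := fun y κ =>
    (norm_mlog_le_two_mul ((hr y κ).trans (by linarith))).trans (by linarith [hr y κ])
  have hval : ∀ (y : Site (d + 1)) (κ : Fin (d + 1)),
      ((gaugeAct (fun y => expUnit (σ y)) W y κ : (Matrix n n ℂ)ˣ) : Matrix n n ℂ) = exp (σ y) * exp (A y κ) * exp (-σ (y + e κ)) := by
    intro y κ
    simp only [gaugeAct, Units.val_mul, val_inv_expUnit, val_expUnit, hWA]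
  -- the new links
  have hlink : ∀ (y : Site (d + 1)) (κ : Fin (d + 1)),
      ‖((gaugeAct (fun y => expUnit (σ y)) W y κ : (Matrix n n ℂ)ˣ) : Matrix n n ℂ) - 1‖ ≤ 2 * ρ₁ + 8 * (t + δ) * δ := by
    intro y κ
    rw [hval]
    have h := NE7GaugeStepLetters.norm_gaugeStep_link_sub_one_le (hσs y) (hσs (y + e κ)) ((hAn y κ).trans (by linarith)) ((hσn y).trans (by linarith))
      ((hdσ y κ).trans (by linarith))
    refine h.trans (add_le_add ?_ ?_)
    · linarith [hρ₁ y κ]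
    · have h1 : ‖σ y‖ + ‖σ (y + e κ) - σ y‖ ≤ t + δ := add_le_add (hσn y) (hdσ y κ)
      have h2 := norm_nonneg (σ (y + e κ) - σ y)
      calc 8 * (‖σ y‖ + ‖σ (y + e κ) - σ y‖) * ‖σ (y + e κ) - σ y‖ ≤ 8 * (t + δ) * δ := by gcongr; exact hdσ y κ
        _ = 8 * (t + δ) * δ := rfl
  -- the new log-links
  set A' : Site (d + 1) → Fin (d + 1) → Matrix n n ℂ :=
    fun y κ => mlog ((gaugeAct (fun y => expUnit (σ y)) W y κ : (Matrix n n ℂ)ˣ) : Matrix n n ℂ) with hA'def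
  have hWA' : ∀ (y : Site (d + 1)) (κ : Fin (d + 1)), ((gaugeAct (fun y => expUnit (σ y)) W y κ : (Matrix n n ℂ)ˣ) : Matrix n n ℂ) = exp (A' y κ) :=
    fun y κ => (exp_mlog ((hlink y κ).trans_lt (by linarith))).symm
  have hA'n : ∀ (y : Site (d + 1)) (κ : Fin (d + 1)), ‖A' y κ‖ ≤ 2 * (2 * ρ₁ + 8 * (t + δ) * δ) := fun y κ =>
    (norm_mlog_le_two_mul ((hlink y κ).trans (by linarith))).trans (by linarith [hlink y κ])
  have hdev : ∀ (y : Site (d + 1)) (κ : Fin (d + 1)), ‖A' y κ - (A y κ - (σ (y + e κ) - σ y))‖ ≤ 4 * (t + δ) * (2 * r + δ) := by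
    intro y κ
    simp only [hA'def, hval y κ]
    exact norm_mlog_gaugeStep_sub_linear_le (hσs y) (hσn y) (hAn y κ) (hdσ y κ) ht (by linarith) hδ
  have hDiff : ∀ (y : Site (d + 1)) (κ : Fin (d + 1)), ‖A' y κ - A y κ‖ ≤ δ + 4 * (t + δ) * (2 * r + δ) := by
    intro y κ
    calc ‖A' y κ - A y κ‖ = ‖(A' y κ - (A y κ - (σ (y + e κ) - σ y))) + -(σ (y + e κ) - σ y)‖ := by congr 1; abel
      _ ≤ 4 * (t + δ) * (2 * r + δ) + δ := (norm_add_le _ _).trans (add_le_add (hdev y κ) (by rw [norm_neg]; exact hdσ y κ))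
      _ = δ + 4 * (t + δ) * (2 * r + δ) := add_comm _ _
  refine ⟨hgU, hgP, hW'u, hW'P, hW'ε, hlink, hdev, fun x μ ν => ?_⟩
  exact norm_curlAt_flat_sub_le_of_gaugeAct hε hWε hWA hσs hσn (by linarith) hWA' (fun y κ => (hAn y κ).trans hρa) (fun y κ => (hA'n y κ).trans hρb)
    hDiff x μ ν

end

end Summit.QuantumFields.BalabanUV.T4Continuum.NE7GaugeStepDeviation
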